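import Literature.Analysis.PDE.ABPPointwise
import Mathlib.Analysis.InnerProductSpace.Calculus
import HarnessLib

/-!
# Calculus of the Krylov–Safonov cutoff `η = (1 - |x|²)^β` (Gilbarg–Trudinger (9.49), p. 247)

For `η(x) = (1 - ‖x‖²)^{m+2}` on a real inner product space we compute the first and second
Fréchet derivatives and the Hessian matrix in an orthonormal frame `b`:
`D η(x) v = -2(m+2)(1-s)^{m+1} ⟪x,v⟫`, `s = ‖x‖²`, and
`(H_η)_{ij} = 4(m+2)(m+1)(1-s)^m x_i x_j - 2(m+2)(1-s)^{m+1} δ_{ij}`, `x_i = ⟪x, b_i⟫`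
(`hessianMatrix_eta`), which is the matrix appearing in
`Literature.Analysis.PDE.KrylovSafonov.eta_hessian_pair_nonneg` with `β = m + 2`.

## References

* D. Gilbarg, N. S. Trudinger, *Elliptic Partial Differential Equations of Second Order* (2001),
  (9.49) and proof of Theorem 9.22 ("Next we calculate a^{ij}D_{ij}η = …"). [GilbargTrudinger2001]
-/

noncomputable section

open Set InnerProductSpace RealInnerProductSpace Matrix
open scoped Topology

namespace Literature.Analysis.PDE.KrylovSafonov

open Literature.Analysis.PDE.ABP

variable {E : Type*} [NormedAddCommGroup E] [InnerProductSpace ℝ E]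
  {ι : Type*} [Fintype ι] [DecidableEq ι]

/-- The cutoff `η_m(x) = (1 - ‖x‖²)^{m+2}` (exponent `β = m + 2 ≥ 2`).
[cite: GilbargTrudinger2001, (9.49)] -/
def eta (m : ℕ) (x : E) : ℝ := (1 - ‖x‖ ^ 2) ^ (m + 2)

/-- The scalar factor of `Dη`: `φ(x) = -2(m+2)(1-‖x‖²)^{m+1}`. [folklore] -/
def etaD1 (m : ℕ) (x : E) : ℝ := -(2 * ((m : ℝ) + 2) * (1 - ‖x‖ ^ 2) ^ (m + 1))

/-- The scalar factor of the rank-one part of `D²η`: `4(m+2)(m+1)(1-‖x‖²)^m`. [folklore] -/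
def etaD2 (m : ℕ) (x : E) : ℝ := 4 * ((m : ℝ) + 2) * ((m : ℝ) + 1) * (1 - ‖x‖ ^ 2) ^ m

omit [DecidableEq ι] [Fintype ι] in
/-- **First derivative of the cutoff**: `Dη(x) = φ(x) ⟪x, ·⟫`. [cite: GilbargTrudinger2001, p. 247] -/
theorem hasFDerivAt_eta (m : ℕ) (x : E) :
    HasFDerivAt (eta (E := E) m) (etaD1 m x • innerSL ℝ x) x := by
  have h1 : HasFDerivAt (fun y : E ↦ ‖y‖ ^ 2) (2 • innerSL ℝ x) x :=
    (hasStrictFDerivAt_norm_sq x).hasFDerivAt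
  have h2 : HasDerivAt (fun s : ℝ ↦ (1 - s) ^ (m + 2))
      (((m + 2 : ℕ) : ℝ) * (1 - ‖x‖ ^ 2) ^ (m + 2 - 1) * (-1)) (‖x‖ ^ 2) :=
    ((hasDerivAt_id (‖x‖ ^ 2)).const_sub 1).pow (m + 2)
  have h3 := h2.comp_hasFDerivAt x h1
  have heq : (fun s : ℝ ↦ (1 - s) ^ (m + 2)) ∘ (fun y : E ↦ ‖y‖ ^ 2) = eta m := by
    funext y; rfl
  rw [heq, show m + 2 - 1 = m + 1 by omega] at h3
  refine h3.congr_fderiv (ContinuousLinearMap.ext fun v ↦ ?_)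
  have e : ∀ v w : E, innerSL ℝ v w = ⟪v, w⟫ := fun _ _ ↦ rfl
  simp [e, etaD1]
  ring

omit [DecidableEq ι] [Fintype ι] in
/-- `fderiv η` as a function. [folklore] -/
theorem fderiv_eta (m : ℕ) : fderiv ℝ (eta (E := E) m) = fun x ↦ etaD1 m x • innerSL ℝ x :=
  funext fun x ↦ (hasFDerivAt_eta m x).fderiv

omit [DecidableEq ι] [Fintype ι] in
/-- Derivative of the scalar factor `φ`: `Dφ(x) = 4(m+2)(m+1)(1-s)^m ⟪x,·⟫ = etaD2 • ⟪x,·⟫`.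
[folklore] -/
theorem hasFDerivAt_etaD1 (m : ℕ) (x : E) :
    HasFDerivAt (etaD1 (E := E) m) (etaD2 m x • innerSL ℝ x) x := by
  have h1 : HasFDerivAt (fun y : E ↦ ‖y‖ ^ 2) (2 • innerSL ℝ x) x :=
    (hasStrictFDerivAt_norm_sq x).hasFDerivAt
  have h2 : HasDerivAt (fun s : ℝ ↦ -(2 * ((m : ℝ) + 2) * (1 - s) ^ (m + 1)))
      (-(2 * ((m : ℝ) + 2) * (((m + 1 : ℕ) : ℝ) * (1 - ‖x‖ ^ 2) ^ (m + 1 - 1) * (-1))))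
      (‖x‖ ^ 2) :=
    ((((hasDerivAt_id (‖x‖ ^ 2)).const_sub 1).pow (m + 1)).const_mul _).neg
  have h3 := h2.comp_hasFDerivAt x h1
  have heq : (fun s : ℝ ↦ -(2 * ((m : ℝ) + 2) * (1 - s) ^ (m + 1))) ∘ (fun y : E ↦ ‖y‖ ^ 2) =
      etaD1 m := by
    funext y; rfl
  rw [heq, show m + 1 - 1 = m by omega] at h3
  refine h3.congr_fderiv (ContinuousLinearMap.ext fun v ↦ ?_)
  have e : ∀ v w : E, innerSL ℝ v w = ⟪v, w⟫ := fun _ _ ↦ rfl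
  simp [e, etaD2]
  ring

omit [DecidableEq ι] [Fintype ι] in
/-- **Second derivative of the cutoff**:
`D²η(x)(v)(w) = etaD2(x) ⟪x,v⟫⟪x,w⟫ + etaD1(x) ⟪v,w⟫`. [cite: GilbargTrudinger2001, p. 247] -/
theorem hasFDerivAt_fderiv_eta (m : ℕ) (x : E) :
    HasFDerivAt (fderiv ℝ (eta (E := E) m))
      (etaD1 m x • (innerSL ℝ : E →L[ℝ] E →L[ℝ] ℝ) +
        (etaD2 m x • innerSL ℝ x).smulRight (innerSL ℝ x)) x := by
  rw [fderiv_eta]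
  exact (hasFDerivAt_etaD1 m x).smul ((innerSL ℝ : E →L[ℝ] E →L[ℝ] ℝ).hasFDerivAt)

omit [DecidableEq ι] [Fintype ι] in
/-- The second derivative, evaluated. [cite: GilbargTrudinger2001, p. 247] -/
theorem fderiv_fderiv_eta_apply (m : ℕ) (x v w : E) :
    fderiv ℝ (fderiv ℝ (eta m)) x v w = etaD2 m x * ⟪x, v⟫ * ⟪x, w⟫ + etaD1 m x * ⟪v, w⟫ := by
  rw [(hasFDerivAt_fderiv_eta m x).fderiv]
  have e : ∀ v w : E, innerSL ℝ v w = ⟪v, w⟫ := fun _ _ ↦ rfl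
  simp [ContinuousLinearMap.smulRight_apply, e]
  ring

omit [DecidableEq ι] [Fintype ι] in
/-- `η` is differentiable with differentiable derivative (it is a polynomial in `‖x‖²`). [folklore] -/
theorem differentiableAt_eta (m : ℕ) (x : E) : DifferentiableAt ℝ (eta (E := E) m) x :=
  (hasFDerivAt_eta m x).differentiableAt

omit [DecidableEq ι] [Fintype ι] in
/-- `Dη` is differentiable. [folklore] -/
theorem differentiableAt_fderiv_eta (m : ℕ) (x : E) :
    DifferentiableAt ℝ (fderiv ℝ (eta (E := E) m)) x :=
  (hasFDerivAt_fderiv_eta m x).differentiableAt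

/-- **The Hessian matrix of the cutoff in an orthonormal frame**:
`(H_η)_{ij} = etaD2 · x_i x_j + etaD1 · δ_{ij}`, `x_i = ⟪x, b_i⟫`, i.e.
`H_η = 4β(β-1)(1-s)^{β-2} x xᵀ - 2β(1-s)^{β-1} I` with `β = m+2`.
[cite: GilbargTrudinger2001, p. 247 ("a^{ij}D_{ij}η = -2βa^{ii}(1-|x|²)^{β-1} + 4β(β-1)a^{ij}x_ix_j(1-|x|²)^{β-2}")] -/
theorem hessianMatrix_eta (m : ℕ) (b : OrthonormalBasis ι ℝ E) (x : E) :
    hessianMatrix (eta m) b x =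
      etaD2 m x • vecMulVec (fun i ↦ ⟪x, b i⟫) (fun i ↦ ⟪x, b i⟫) +
        etaD1 m x • (1 : Matrix ι ι ℝ) := by
  ext i j
  rw [hessianMatrix_apply, fderiv_fderiv_eta_apply]
  have hb : ⟪b i, b j⟫ = if i = j then (1 : ℝ) else 0 := orthonormal_iff_ite.1 b.orthonormal i j
  simp only [vecMulVec_apply, Matrix.add_apply, Matrix.smul_apply, Matrix.one_apply, hb, smul_eq_mul,
    mul_ite, mul_one, mul_zero]
  ring

omit [DecidableEq ι] in
/-- `‖x‖² = Σ_i ⟪x, b_i⟫²` — the coordinate vector has the same square norm. [folklore] -/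
theorem normSq_eq_dotProduct (b : OrthonormalBasis ι ℝ E) (x : E) :
    ‖x‖ ^ 2 = (fun i ↦ ⟪x, b i⟫) ⬝ᵥ (fun i ↦ ⟪x, b i⟫) := by
  rw [← b.sum_sq_inner_left x]
  simp [dotProduct, pow_two]

/-- **The cutoff Hessian in the format of the pointwise file**: with `β = m + 2` and
`s = x ⬝ x` for the coordinate vector `x_i = ⟪x, b_i⟫`,
`H_η = (4β(β-1)(1-s)^{β-2}) • x xᵀ - (2β(1-s)^{β-1}) • I`. [cite: GilbargTrudinger2001, p. 247] -/
theorem hessianMatrix_eta_eq (m : ℕ) (b : OrthonormalBasis ι ℝ E) (x : E) :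
    hessianMatrix (eta m) b x =
      (4 * ((m + 2 : ℕ) : ℝ) * (((m + 2 : ℕ) : ℝ) - 1) *
          (1 - (fun i ↦ ⟪x, b i⟫) ⬝ᵥ (fun i ↦ ⟪x, b i⟫)) ^ (m + 2 - 2)) •
        vecMulVec (fun i ↦ ⟪x, b i⟫) (fun i ↦ ⟪x, b i⟫) -
      (2 * ((m + 2 : ℕ) : ℝ) * (1 - (fun i ↦ ⟪x, b i⟫) ⬝ᵥ (fun i ↦ ⟪x, b i⟫)) ^ (m + 2 - 1)) •
        (1 : Matrix ι ι ℝ) := by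
  rw [hessianMatrix_eta, ← normSq_eq_dotProduct b x, show m + 2 - 2 = m by omega,
    show m + 2 - 1 = m + 1 by omega, sub_eq_add_neg, ← neg_smul]
  congr 2
  · rw [etaD2]; push_cast; ring
  · rw [etaD1]; push_cast; ring

omit [DecidableEq ι] in
/-- **The cutoff gradient in coordinates**: `(Dη(x)(b_i))_i = (-(2β(1-s)^{β-1})) • x`.
[cite: GilbargTrudinger2001, p. 247] -/
theorem fderiv_eta_coord (m : ℕ) (b : OrthonormalBasis ι ℝ E) (x : E) :
    (fun i ↦ fderiv ℝ (eta m) x (b i)) =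
      (-(2 * ((m + 2 : ℕ) : ℝ) * (1 - (fun i ↦ ⟪x, b i⟫) ⬝ᵥ (fun i ↦ ⟪x, b i⟫)) ^ (m + 2 - 1))) •
        fun i ↦ ⟪x, b i⟫ := by
  funext i
  rw [fderiv_eta, ← normSq_eq_dotProduct b x, show m + 2 - 1 = m + 1 by omega]
  simp [etaD1]

end Literature.Analysis.PDE.KrylovSafonov

end
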